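import Summits.HodgeConjecture.HodgeConjecture.Theorems.F0P2oLineJacquetHolds          -- (JA) F0P2-p06 (g4): `thetaType_nonsplit_jacquetModule_holds` (N3 #96, hypothesis-free)
import Summits.HodgeConjecture.HodgeConjecture.Theorems.F0P2oLettersOfN3               -- ★ p837697 (this seat): `xiLocalPacket_nonsplit_isThetaPair_of_N3`
import Summits.HodgeConjecture.HodgeConjecture.Theorems.F0P2pGR91NOfN3                 -- ★ p833094 F0P2-p06 (g2): `u1ThetaDichotomy_nonsplit_of_N3`, `GR91Lemma512NonsplitAsPrinted_of_N3`
import Summits.HodgeConjecture.HodgeConjecture.Theorems.F0P3KeysCaseTwoReducibleOfN3   -- ★ p835809 B-p14 (g28): `keysCaseTwoReducible_of_N3`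
import HarnessLib

/-!
# Crux `H413`, programme P2 — THE LOCAL LETTERS HOLD: #104∕#75-loc (T7), #97 (U1), #76 (U′-N), #106 (Keys case two), HYPOTHESIS-FREE, over N3 #96 ★

Cell hodgecm-mathlib (D-0151), FLOOR 0, crux item H413 = stmt-HodgeConjecture-24833, programme P2; seat F0P2-p02 (g7), row (LH) (bid 2026-09-01T00:5xZ to the K1∕N3
lead B-p18 (g29)).  THEOREMS ONLY — four NAMED-FACT DISCHARGES `theorem X_holds : X` of ★-typed print letters `def X : Prop`, each ONE application of a ★ `…_of_N3`
reduction to F0P2-p06 (g4)'s hypothesis-free N3 closer `F0P2oLineJacquetHolds.thetaType_nonsplit_jacquetModule_holds` ((JA), over the in-house (a)-road (N′)∕(C4)∕(C5)∕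
(BF)∕(LS)∕(LM)∕(KL)∕(SJ)∕(J1)–(J4) of 2026-08-31∕09-01 and the (D3d) clause-(b) chain).  No `def`, no instance, no notation, no `sorry`; no `Cruxes/…/Lines` import (O50-1);
kernel lane `--supports stmt-HodgeConjecture-24833 --as helper`.  HC_CM is proved only modulo the 2 remaining named inputs (hLiu418, h413) — behind them the booked
printed statements + the MOD package — until rung 0 closes.

* `xiLocalPacket_nonsplit_isThetaPair_holds` — #104∕#75-loc [GelbartRogawski1991 Lem. 5.1.2 p. 466, Cor. 5.2.2 p. 467] (★ p837697 `…_of_N3`: the T7 composition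
  ★ p829745 fed ★ K1w p833012, ★ U1⟸N3 p833094, ★ N6 p831380, ★ LABEL p831648 over N3∕N6∕★ N7 p835805);
* `u1ThetaDichotomy_nonsplit_holds` — #97 [GelbartRogawski1991 §5.2; HarrisKudlaSweet1996 Cor. 4.4] (★ p833094 ⟸ N3, over the tower road ★ p829230 and ★ p832406);
* `GR91Lemma512NonsplitAsPrinted_holds` — #76 U′-N [GelbartRogawski1991 Lem. 5.1.2 p. 466] (★ p833094 `GR91Lemma512NonsplitAsPrinted_of_N3` over ★ K1w);
* `keysCaseTwoReducible_holds (L)` ∕ `keysCaseTwoReducible_closed_holds` — #106 [Rogawski1990 §12.2 (2) pp. 173–174] (★ p835809 `keysCaseTwoReducible_of_N3`).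

## References
* [GelbartRogawski1991] S. Gelbart, J. Rogawski, Invent. Math. 105 (1991): §3.2 p. 457; Lem. 5.1.2 p. 466; §5.2 Cor. 5.2.2 p. 467.
* [Rogawski1990] J. Rogawski, Ann. of Math. Stud. 123 (1990): §12.2 (2) pp. 173–174.
* [Kudla1986] S. Kudla, Invent. Math. 83 (1986): Thm. 2.8.
-/

set_option autoImplicit false
-- the mandated namespace repeats the single-problem summit's segment (`HodgeConjecture.HodgeConjecture`)
set_option linter.dupNamespace false

noncomputable section

open NumberField
open Summit.HodgeConjecture.HodgeConjecture.Cruxes.H413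

namespace Summit.HodgeConjecture.HodgeConjecture.Cruxes.H413.F0P2oLocalLettersHold

set_option synthInstance.maxHeartbeats 400000 in
set_option maxHeartbeats 8000000 in
/-- **#104∕#75-loc `GelbartRogawski1991.xiLocalPacket_nonsplit_isThetaPair` HOLDS** (hypothesis-free): ★ p837697 `xiLocalPacket_nonsplit_isThetaPair_of_N3` at the ★ N3
closer `F0P2oLineJacquetHolds.thetaType_nonsplit_jacquetModule_holds`. [cite: GelbartRogawski1991, Lem. 5.1.2 p. 466; §5.2 Cor. 5.2.2 p. 467] [cite: Kudla1986, Thm. 2.8] -/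
theorem xiLocalPacket_nonsplit_isThetaPair_holds : Literature.NumberTheory.GelbartRogawski1991.xiLocalPacket_nonsplit_isThetaPair :=
  F0P2oLettersOfN3.xiLocalPacket_nonsplit_isThetaPair_of_N3 F0P2oLineJacquetHolds.thetaType_nonsplit_jacquetModule_holds

set_option synthInstance.maxHeartbeats 400000 in
set_option maxHeartbeats 8000000 in
/-- **#97 `GelbartRogawski1991.u1ThetaDichotomy_nonsplit` HOLDS** (hypothesis-free): ★ p833094 `u1ThetaDichotomy_nonsplit_of_N3` at the ★ N3 closer.
[cite: GelbartRogawski1991, §5.2 Cor. 5.2.2 p. 467] [cite: Kudla1986, Thm. 2.8] -/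
theorem u1ThetaDichotomy_nonsplit_holds : Literature.NumberTheory.GelbartRogawski1991.u1ThetaDichotomy_nonsplit :=
  F0P2pGR91NOfN3.u1ThetaDichotomy_nonsplit_of_N3 F0P2oLineJacquetHolds.thetaType_nonsplit_jacquetModule_holds

set_option synthInstance.maxHeartbeats 400000 in
set_option maxHeartbeats 8000000 in
/-- **#76 U′-N `GelbartRogawski1991.GR91Lemma512NonsplitAsPrinted` HOLDS** (hypothesis-free): ★ p833094 `GR91Lemma512NonsplitAsPrinted_of_N3` at the ★ N3 closer.
[cite: GelbartRogawski1991, Lem. 5.1.2 p. 466] -/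
theorem GR91Lemma512NonsplitAsPrinted_holds : Literature.NumberTheory.GelbartRogawski1991.GR91Lemma512NonsplitAsPrinted :=
  F0P2pGR91NOfN3.GR91Lemma512NonsplitAsPrinted_of_N3 F0P2oLineJacquetHolds.thetaType_nonsplit_jacquetModule_holds

set_option synthInstance.maxHeartbeats 400000 in
set_option maxHeartbeats 8000000 in
/-- **#106 `Rogawski1990.KeysCaseTwoReducible L` HOLDS at every CM field `L`** (hypothesis-free): ★ p835809 `keysCaseTwoReducible_of_N3` at the ★ N3 closer.
[cite: Rogawski1990, §12.2 (2) pp. 173–174] [cite: GelbartRogawski1991, Lem. 5.1.2 p. 466] -/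
theorem keysCaseTwoReducible_holds (L : Type) [Field L] [NumberField L] [IsCMField L] :
    Literature.NumberTheory.Rogawski1990.KeysCaseTwoReducible L :=
  F0P3KeysCaseTwoReducibleOfN3.keysCaseTwoReducible_of_N3 L F0P2oLineJacquetHolds.thetaType_nonsplit_jacquetModule_holds

set_option synthInstance.maxHeartbeats 400000 in
set_option maxHeartbeats 8000000 in
/-- **#106 ∀-closed over CM fields** (the P3 closer's `stub_N4` ∕ T3b's binder shape): ★ p835809 `keysCaseTwoReducible_closed_of_N3` at the ★ N3 closer.
[cite: Rogawski1990, §12.2 (2) pp. 173–174] -/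
theorem keysCaseTwoReducible_closed_holds :
    ∀ (L : Type) [Field L] [NumberField L] [IsCMField L], Literature.NumberTheory.Rogawski1990.KeysCaseTwoReducible L :=
  F0P3KeysCaseTwoReducibleOfN3.keysCaseTwoReducible_closed_of_N3 F0P2oLineJacquetHolds.thetaType_nonsplit_jacquetModule_holds

end Summit.HodgeConjecture.HodgeConjecture.Cruxes.H413.F0P2oLocalLettersHold

end
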